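import Mathlib
import Literature.Analysis.FluidPDE.VectorCalculus
import Literature.Analysis.FluidPDE.TaoAveragedNondegeneracy
import Literature.Analysis.FluidPDE.LeiZhang2011Proofs

/-!
# The END CONE LAW of equilibrium filaments (SC-free, exact)
(helper for crux `FilamentSkeletonRss.SkeletonEquilibrium`, stmt-NavierStokesRegularity-15400: structural input for
the registered stubs `stub_lengthRegular` (all negation lines) and `stub_outerShadowing` / `stub_kelvinSonicVerticality`
(outer geometry of proper ends); companion of `…LengthRegularRadial`)

Pairing the tangency relation `u + ½Ξ − α e₃×Ξ = w T` (`‖T‖ = 1`) of ONE filament point with `Ξ` AND with `T` and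
eliminating the slip `w` gives an EXACT algebraic identity free of `w` (`cone_identity`):

  `⟪T,Ξ⟫² − 2α ⟪T,Ξ⟫ ⟪T, e₃×Ξ⟫ − ‖Ξ‖² = 2 (⟪u,Ξ⟫ − ⟪T,Ξ⟫ ⟪u,T⟫)`.

Consequences under a bound `‖u‖ ≤ U` on the skeleton velocity at the point (no stagnation / unique-zero clause):
* `cone_law` — `|⟪T,Ξ⟫² − 2α⟪T,Ξ⟫⟪T,e₃×Ξ⟫ − ‖Ξ‖²| ≤ 4U‖Ξ‖`: in terms of the radial and azimuthal components
  `ξ = ⟪T, Ξ/‖Ξ‖⟫`, `η = ⟪T, e₃×Ξ/‖Ξ‖⟫` of the unit tangent, `|ξ² − 2αξη − 1| ≤ 4U/‖Ξ‖` — far out, the tangent lies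
  near the cone `ξ² − 2αξη = 1` (the vertical axis `ξ = 1, η = 0` is on it; so are the binormal spirals `η ≠ 0`);
* `winding_sign` — `α ⟪T,Ξ⟫ ⟪T,e₃×Ξ⟫ ≤ 2U‖Ξ‖`: moving outward (`ξ > 0`) the filament winds about the axis AGAINST
  the frame rotation (`αη ≲ 0`), moving inward with it — the handedness of the end spirals;
* `radial_quadratic_ge` — `⟪T,Ξ⟫² + 2|α|‖Ξ‖|⟪T,Ξ⟫| ≥ ‖Ξ‖² − 4U‖Ξ‖` (whence `|ξ| ≳ √(1+α²) − |α|` far out, sharper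
  than the `(3+4|α|)⁻¹` of `LengthRegular.norm_le_mul_abs_inner`);
* `end_cone_asymptotics` — along a proper filament (`‖Ξ τ‖ → ∞`) with `‖u‖ ≤ U`: `ξ(τ)² − 2α ξ(τ) η(τ) → 1`.
No summit statement is proved; NS regularity is not touched.
-/

noncomputable section

open Set Filter Topology
open Literature.Analysis.FluidPDE Literature.Analysis.FluidPDE.Tao2016
open scoped RealInnerProductSpace InnerProductSpace

namespace Summit.NavierStokesRegularity.NavierStokesRegularity.Theorems.SkeletonEquilibrium.EndConeLaw
set_option linter.dupNamespace false

/-- **Cone identity (exact, slip-free).** If `u + ½Ξ − α e₃×Ξ = w T` with `‖T‖ = 1` then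
`⟪T,Ξ⟫² − 2α⟪T,Ξ⟫⟪T,e₃×Ξ⟫ − ‖Ξ‖² = 2(⟪u,Ξ⟫ − ⟪T,Ξ⟫⟪u,T⟫)` (pair with `Ξ`: `w⟪T,Ξ⟫ = ⟪u,Ξ⟫ + ½‖Ξ‖²`; pair with
`T`: `w = ⟪u,T⟫ + ½⟪T,Ξ⟫ − α⟪T,e₃×Ξ⟫`; eliminate `w`). [folklore] -/
theorem cone_identity (α w : ℝ) (u Ξ T : EuclideanSpace ℝ (Fin 3))
    (h : u + (1 / 2 : ℝ) • Ξ - α • cross (EuclideanSpace.single (2 : Fin 3) (1 : ℝ)) Ξ = w • T)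
    (hT : ‖T‖ = 1) :
    ⟪T, Ξ⟫ ^ 2 - 2 * α * ⟪T, Ξ⟫ * ⟪T, cross (EuclideanSpace.single (2 : Fin 3) (1 : ℝ)) Ξ⟫ - ‖Ξ‖ ^ 2
      = 2 * (⟪u, Ξ⟫ - ⟪T, Ξ⟫ * ⟪u, T⟫) := by
  have h1 : w * ⟪T, Ξ⟫ = ⟪u, Ξ⟫ + 1 / 2 * ‖Ξ‖ ^ 2 := by
    have := congrArg (fun v => ⟪v, Ξ⟫) h
    simp only [inner_add_left, inner_sub_left, real_inner_smul_left, inner_cross_self_right,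
      mul_zero, sub_zero, real_inner_self_eq_norm_sq] at this
    linarith
  have h2 : w = ⟪u, T⟫ + 1 / 2 * ⟪T, Ξ⟫
      - α * ⟪T, cross (EuclideanSpace.single (2 : Fin 3) (1 : ℝ)) Ξ⟫ := by
    have := congrArg (fun v => ⟪v, T⟫) h
    simp only [inner_add_left, inner_sub_left, real_inner_smul_left, real_inner_self_eq_norm_sq, hT,
      one_pow, mul_one] at this
    rw [real_inner_comm T Ξ, real_inner_comm T (cross _ Ξ)] at this
    linarith
  rw [h2] at h1
  linear_combination 2 * h1

/-- **Cone law.** With `‖u‖ ≤ U`: `|⟪T,Ξ⟫² − 2α⟪T,Ξ⟫⟪T,e₃×Ξ⟫ − ‖Ξ‖²| ≤ 4U‖Ξ‖`, i.e. for the radial / azimuthal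
components `ξ, η` of the unit tangent, `|ξ² − 2αξη − 1| ≤ 4U/‖Ξ‖`. [folklore] -/
theorem cone_law (α w U : ℝ) (u Ξ T : EuclideanSpace ℝ (Fin 3))
    (h : u + (1 / 2 : ℝ) • Ξ - α • cross (EuclideanSpace.single (2 : Fin 3) (1 : ℝ)) Ξ = w • T)
    (hT : ‖T‖ = 1) (hu : ‖u‖ ≤ U) :
    |⟪T, Ξ⟫ ^ 2 - 2 * α * ⟪T, Ξ⟫ * ⟪T, cross (EuclideanSpace.single (2 : Fin 3) (1 : ℝ)) Ξ⟫ - ‖Ξ‖ ^ 2|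
      ≤ 4 * U * ‖Ξ‖ := by
  rw [cone_identity α w u Ξ T h hT]
  have hq : |⟪u, Ξ⟫| ≤ ‖u‖ * ‖Ξ‖ := abs_real_inner_le_norm u Ξ
  have ha : |⟪T, Ξ⟫| ≤ ‖Ξ‖ := by
    have := abs_real_inner_le_norm T Ξ; rwa [hT, one_mul] at this
  have hp : |⟪u, T⟫| ≤ ‖u‖ := by
    have := abs_real_inner_le_norm u T; rwa [hT, mul_one] at this
  have hg : 0 ≤ ‖Ξ‖ := norm_nonneg _
  have hU0 : 0 ≤ U := le_trans (norm_nonneg _) hu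
  have h1 : |⟪u, Ξ⟫| ≤ U * ‖Ξ‖ := le_trans hq (mul_le_mul_of_nonneg_right hu hg)
  have h2 : |⟪T, Ξ⟫ * ⟪u, T⟫| ≤ ‖Ξ‖ * U := by
    rw [abs_mul]; exact mul_le_mul ha (le_trans hp hu) (abs_nonneg _) hg
  calc |2 * (⟪u, Ξ⟫ - ⟪T, Ξ⟫ * ⟪u, T⟫)| = 2 * |⟪u, Ξ⟫ - ⟪T, Ξ⟫ * ⟪u, T⟫| := by
        rw [abs_mul, abs_of_pos (by norm_num : (0:ℝ) < 2)]
    _ ≤ 2 * (|⟪u, Ξ⟫| + |⟪T, Ξ⟫ * ⟪u, T⟫|) := by gcongr; exact abs_sub _ _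
    _ ≤ 2 * (U * ‖Ξ‖ + ‖Ξ‖ * U) := by gcongr
    _ = 4 * U * ‖Ξ‖ := by ring

/-- **Handedness of the end spirals.** With `‖u‖ ≤ U`: `α⟪T,Ξ⟫⟪T,e₃×Ξ⟫ ≤ 2U‖Ξ‖` — moving outward the filament winds
about `e₃` against the frame rotation `α`, moving inward with it, up to `O(U/‖Ξ‖)`. [folklore] -/
theorem winding_sign (α w U : ℝ) (u Ξ T : EuclideanSpace ℝ (Fin 3))
    (h : u + (1 / 2 : ℝ) • Ξ - α • cross (EuclideanSpace.single (2 : Fin 3) (1 : ℝ)) Ξ = w • T)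
    (hT : ‖T‖ = 1) (hu : ‖u‖ ≤ U) :
    α * ⟪T, Ξ⟫ * ⟪T, cross (EuclideanSpace.single (2 : Fin 3) (1 : ℝ)) Ξ⟫ ≤ 2 * U * ‖Ξ‖ := by
  have hid := cone_identity α w u Ξ T h hT
  have hc := cone_law α w U u Ξ T h hT hu
  have ha : |⟪T, Ξ⟫| ≤ ‖Ξ‖ := by
    have := abs_real_inner_le_norm T Ξ; rwa [hT, one_mul] at this
  have ha2 : ⟪T, Ξ⟫ ^ 2 ≤ ‖Ξ‖ ^ 2 := by
    rw [← sq_abs]; exact pow_le_pow_left₀ (abs_nonneg _) ha 2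
  have hlow := (abs_le.1 hc).1
  nlinarith

/-- **Radial transversality, quadratic form.** With `‖u‖ ≤ U`:
`⟪T,Ξ⟫² + 2|α|‖Ξ‖|⟪T,Ξ⟫| ≥ ‖Ξ‖² − 4U‖Ξ‖`; far out this gives `|ξ| ≥ √(1+α²) − |α| − o(1)` for the radial
component `ξ` of the unit tangent. [folklore] -/
theorem radial_quadratic_ge (α w U : ℝ) (u Ξ T : EuclideanSpace ℝ (Fin 3))
    (h : u + (1 / 2 : ℝ) • Ξ - α • cross (EuclideanSpace.single (2 : Fin 3) (1 : ℝ)) Ξ = w • T)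
    (hT : ‖T‖ = 1) (hu : ‖u‖ ≤ U) :
    ‖Ξ‖ ^ 2 - 4 * U * ‖Ξ‖ ≤ ⟪T, Ξ⟫ ^ 2 + 2 * |α| * ‖Ξ‖ * |⟪T, Ξ⟫| := by
  have hc := cone_law α w U u Ξ T h hT hu
  have hb : |⟪T, cross (EuclideanSpace.single (2 : Fin 3) (1 : ℝ)) Ξ⟫| ≤ ‖Ξ‖ := by
    have h1 := abs_real_inner_le_norm T (cross (EuclideanSpace.single (2 : Fin 3) (1 : ℝ)) Ξ)
    rw [hT, one_mul] at h1
    have h2 := norm_cross_le_norm_mul_norm (EuclideanSpace.single (2 : Fin 3) (1 : ℝ)) Ξ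
    have he : ‖(EuclideanSpace.single (2 : Fin 3) (1 : ℝ))‖ = 1 := by simp
    rw [he, one_mul] at h2
    exact le_trans h1 h2
  have hlow := (abs_le.1 hc).1
  -- -2|α| ‖Ξ‖ |a| ≤ 2α a b
  have hcross : -(2 * |α| * ‖Ξ‖ * |⟪T, Ξ⟫|)
      ≤ 2 * α * ⟪T, Ξ⟫ * ⟪T, cross (EuclideanSpace.single (2 : Fin 3) (1 : ℝ)) Ξ⟫ := by
    have h1 := neg_abs_le (2 * α * ⟪T, Ξ⟫ * ⟪T, cross (EuclideanSpace.single (2 : Fin 3) (1 : ℝ)) Ξ⟫)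
    rw [abs_mul, abs_mul, abs_mul, abs_of_pos (by norm_num : (0:ℝ) < 2)] at h1
    have h2 : 2 * |α| * |⟪T, Ξ⟫| * |⟪T, cross (EuclideanSpace.single (2 : Fin 3) (1 : ℝ)) Ξ⟫|
        ≤ 2 * |α| * |⟪T, Ξ⟫| * ‖Ξ‖ := by gcongr
    linarith
  linarith

/-- **End cone asymptotics.** Along a proper filament (`‖Ξ τ‖ → ∞`) satisfying the tangency relation with
`‖u‖ ≤ U`, the radial and azimuthal components `ξ(τ) = ⟪Ξ′, Ξ⟫/‖Ξ‖`, `η(τ) = ⟪Ξ′, e₃×Ξ⟫/‖Ξ‖` of the unit tangent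
satisfy `ξ² − 2αξη → 1`: the ends are asymptotic to the cone `ξ² − 2αξη = 1`. [folklore] -/
theorem end_cone_asymptotics {Ξ u : ℝ → EuclideanSpace ℝ (Fin 3)} {w : ℝ → ℝ} {α U : ℝ}
    (hT : ∀ τ, ‖deriv Ξ τ‖ = 1)
    (heq : ∀ τ, u τ + (1 / 2 : ℝ) • Ξ τ - α • cross (EuclideanSpace.single (2 : Fin 3) (1 : ℝ)) (Ξ τ)
      = w τ • deriv Ξ τ)
    (hu : ∀ τ, ‖u τ‖ ≤ U) (htop : Tendsto (fun τ => ‖Ξ τ‖) atTop atTop) :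
    Tendsto (fun τ => (⟪deriv Ξ τ, Ξ τ⟫ / ‖Ξ τ‖) ^ 2
        - 2 * α * (⟪deriv Ξ τ, Ξ τ⟫ / ‖Ξ τ‖)
          * (⟪deriv Ξ τ, cross (EuclideanSpace.single (2 : Fin 3) (1 : ℝ)) (Ξ τ)⟫ / ‖Ξ τ‖))
      atTop (𝓝 1) := by
  have h0 : Tendsto (fun τ => 4 * U / ‖Ξ τ‖) atTop (𝓝 0) := tendsto_const_nhds.div_atTop htop
  rw [tendsto_iff_norm_sub_tendsto_zero]
  refine squeeze_zero_norm' ?_ h0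
  filter_upwards [htop.eventually (eventually_gt_atTop 0)] with τ hτ
  simp only [Real.norm_eq_abs, abs_abs]
  have hc := cone_law α (w τ) U (u τ) (Ξ τ) (deriv Ξ τ) (heq τ) (hT τ) (hu τ)
  have hne : ‖Ξ τ‖ ≠ 0 := ne_of_gt hτ
  have key : (⟪deriv Ξ τ, Ξ τ⟫ / ‖Ξ τ‖) ^ 2
        - 2 * α * (⟪deriv Ξ τ, Ξ τ⟫ / ‖Ξ τ‖)
          * (⟪deriv Ξ τ, cross (EuclideanSpace.single (2 : Fin 3) (1 : ℝ)) (Ξ τ)⟫ / ‖Ξ τ‖) - 1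
      = (⟪deriv Ξ τ, Ξ τ⟫ ^ 2
          - 2 * α * ⟪deriv Ξ τ, Ξ τ⟫ * ⟪deriv Ξ τ, cross (EuclideanSpace.single (2 : Fin 3) (1 : ℝ)) (Ξ τ)⟫
          - ‖Ξ τ‖ ^ 2) / ‖Ξ τ‖ ^ 2 := by
    field_simp
  have hpos2 : (0:ℝ) < ‖Ξ τ‖ ^ 2 := by positivity
  rw [key, abs_div, abs_of_pos hpos2, div_le_div_iff₀ hpos2 hτ]
  have := mul_le_mul_of_nonneg_right hc (norm_nonneg (Ξ τ))
  nlinarith [norm_nonneg (Ξ τ)]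

end Summit.NavierStokesRegularity.NavierStokesRegularity.Theorems.SkeletonEquilibrium.EndConeLaw
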